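import Mathlib

/-!
# First-entry time of a curve into an open set — the abstract "cross-turn" step of STUB A
(`stub_upperFence`, line `collar-touch-sandwich`, crux `SLESixFamiliesGiveCardy`,
stmt-CriticalPhenomena-9654)

Refuter helper (drefute gen-4), pure topology, no project imports needed.  In the fence argument
of STUB A the clean cross-cut `L` splits `D ∖ L = U₁ ⊔ U₂` (open, disjoint), the interface polyline
`γ` starts in `U₂` and ends in `U₁`.  `exists_firstEntry` produces the first-entry parameter
`t₀ ∈ (a, b)` with `γ t₀ ∉ U₁ ∪ U₂` (so `γ t₀` is a polyline VERTEX on `L`, not a point of an open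
face), no point of `U₁` before `t₀`, points of `U₁` immediately after `t₀`; and
`firstEntry_no_trap` says that `γ` cannot sit, on a punctured neighbourhood of `t₀`, inside ONE
preconnected set `f ⊆ U₁ ∪ U₂` — which is exactly what a FOLLOW turn of the medial exploration at
`γ t₀` would force (`f` = the open inner face of the turn).  Hence the visit at `t₀` is a CROSS
turn, the crossed edge is `bcBondConfig`-closed, `ω`-open, a `D_δ`-edge, so it has a `zdArcB`
endpoint inside `Ω` (see `DrefuteCollarTouchSandwichG4.md`, §A).
-/

open Set Metric

namespace Summit.CriticalPhenomena.CardyFormulaZ2.Cruxes.SLESixFamiliesGiveCardy.CollarTouchSandwich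

/-- **First entry.**  A curve continuous on `[a, b]`, starting in the open set `U₂` and ending in
the open set `U₁`, `U₁ ∩ U₂ = ∅`, has a first-entry parameter `t₀ ∈ (a, b)` into `U₁`:
`γ t₀ ∉ U₁ ∪ U₂`, no parameter of `[a, t₀]` is mapped into `U₁`, and parameters mapped into `U₁`
exist in every right neighbourhood `(t₀, t₀ + ε)`, inside `[a, b]`. [folklore] -/
theorem exists_firstEntry {X : Type*} [TopologicalSpace X] {γ : ℝ → X} {a b : ℝ}
    (hγ : ContinuousOn γ (Icc a b)) {U₁ U₂ : Set X} (hU₁ : IsOpen U₁) (hU₂ : IsOpen U₂)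
    (hdisj : Disjoint U₁ U₂) (ha : γ a ∈ U₂) (hb : γ b ∈ U₁) (hab : a ≤ b) :
    ∃ t₀ ∈ Ioo a b, γ t₀ ∉ U₁ ∧ γ t₀ ∉ U₂ ∧ (∀ t ∈ Icc a t₀, γ t ∉ U₁) ∧
      ∀ ε > 0, ∃ t ∈ Ioo t₀ (t₀ + ε), t ≤ b ∧ γ t ∈ U₁ := by
  classical
  set S : Set ℝ := {t | t ∈ Icc a b ∧ γ t ∈ U₁} with hS
  have hbS : b ∈ S := ⟨right_mem_Icc.2 hab, hb⟩
  have hSne : S.Nonempty := ⟨b, hbS⟩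
  have hSbdd : BddBelow S := ⟨a, fun t ht => ht.1.1⟩
  set t₀ := sInf S with ht₀
  have hat₀ : a ≤ t₀ := le_csInf hSne fun t ht => ht.1.1
  have ht₀b : t₀ ≤ b := csInf_le hSbdd hbS
  have ht₀I : t₀ ∈ Icc a b := ⟨hat₀, ht₀b⟩
  -- points of `S` just above `t₀`
  have hinf : ∀ ε > 0, ∃ t ∈ S, t < t₀ + ε := fun ε hε =>
    exists_lt_of_csInf_lt hSne (by linarith)
  have hle : ∀ t ∈ S, t₀ ≤ t := fun t ht => csInf_le hSbdd ht
  -- local openness of preimages along `[a, b]`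
  have hnhd : ∀ {U : Set X}, IsOpen U → γ t₀ ∈ U →
      ∃ δ > 0, ∀ t ∈ Icc a b, dist t t₀ < δ → γ t ∈ U := by
    intro U hU hmem
    have hc : ContinuousWithinAt γ (Icc a b) t₀ := hγ t₀ ht₀I
    have hpre : γ ⁻¹' U ∈ nhdsWithin t₀ (Icc a b) := hc (hU.mem_nhds hmem)
    rcases Metric.mem_nhdsWithin_iff.1 hpre with ⟨δ, hδ, hball⟩
    exact ⟨δ, hδ, fun t ht hd => hball ⟨hd, ht⟩⟩
  -- `γ t₀ ∉ U₂`
  have h₂ : γ t₀ ∉ U₂ := by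
    intro hmem
    obtain ⟨δ, hδ, hball⟩ := hnhd hU₂ hmem
    obtain ⟨t, htS, htlt⟩ := hinf δ hδ
    have ht₀t : t₀ ≤ t := hle t htS
    have hd : dist t t₀ < δ := by
      rw [Real.dist_eq, abs_of_nonneg (by linarith)]
      linarith
    exact hdisj.le_bot ⟨htS.2, hball t htS.1 hd⟩
  -- `γ t₀ ∉ U₁`
  have h₁ : γ t₀ ∉ U₁ := by
    intro hmem
    rcases eq_or_lt_of_le hat₀ with h | h
    · exact h₂ (h ▸ ha)
    obtain ⟨δ, hδ, hball⟩ := hnhd hU₁ hmem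
    set t := max a (t₀ - δ / 2) with ht
    have htI : t ∈ Icc a b := ⟨le_max_left _ _, max_le hab (by linarith)⟩
    have htlt : t < t₀ := max_lt h (by linarith)
    have hd : dist t t₀ < δ := by
      rw [Real.dist_eq, abs_sub_comm, abs_of_nonneg (by linarith)]
      have : t₀ - δ / 2 ≤ t := le_max_right _ _
      linarith
    have htS : t ∈ S := ⟨htI, hball t htI hd⟩
    exact absurd (hle t htS) (not_le.2 htlt)
  have ht₀a : a < t₀ := lt_of_le_of_ne hat₀ fun h => h₂ (h ▸ ha)
  have ht₀b' : t₀ < b := lt_of_le_of_ne ht₀b fun h => h₁ (h ▸ hb)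
  refine ⟨t₀, ⟨ht₀a, ht₀b'⟩, h₁, h₂, ?_, ?_⟩
  · intro t ht hmem
    rcases eq_or_lt_of_le ht.2 with h | h
    · exact h₁ (h ▸ hmem)
    · exact absurd (hle t ⟨⟨ht.1, h.le.trans ht₀b⟩, hmem⟩) (not_le.2 h)
  · intro ε hε
    obtain ⟨t, htS, htlt⟩ := hinf ε hε
    have ht₀t : t₀ ≤ t := hle t htS
    have hne : t ≠ t₀ := fun h => h₁ (h ▸ htS.2)
    exact ⟨t, ⟨lt_of_le_of_ne ht₀t (Ne.symm hne), htlt⟩, htS.1.2, htS.2⟩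

/-- **No trap at the first entry.**  With `t₀` as in `exists_firstEntry` (no point of `U₁` on
`[a, t₀]`, points of `U₁` in every `(t₀, t₀ + ε) ∩ [a, b]`, `a < t₀`), the curve cannot stay,
for all parameters `t ≠ t₀` of `[a, b]` within `ε` of `t₀`, inside one preconnected set
`f ⊆ U₁ ∪ U₂`: `f` would lie in `U₂` (it contains the image of a parameter `< t₀`) and in `U₁`
(it contains the image of a parameter of `S` just above `t₀`).  In STUB A: the medial turn at
`γ t₀` is not a FOLLOW turn (whose open inner face would be such an `f`). [folklore] -/
theorem firstEntry_no_trap {X : Type*} [TopologicalSpace X] {γ : ℝ → X} {a b t₀ : ℝ}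
    {U₁ U₂ : Set X} (hU₁ : IsOpen U₁) (hU₂ : IsOpen U₂) (hdisj : Disjoint U₁ U₂)
    (hat₀ : a < t₀) (ht₀b : t₀ ≤ b) (hbefore : ∀ t ∈ Icc a t₀, γ t ∉ U₁)
    (hafter : ∀ ε > 0, ∃ t ∈ Ioo t₀ (t₀ + ε), t ≤ b ∧ γ t ∈ U₁)
    {f : Set X} (hf : IsPreconnected f) (hfU : f ⊆ U₁ ∪ U₂) {ε : ℝ} (hε : 0 < ε)
    (htrap : ∀ t ∈ Icc a b, t ≠ t₀ → dist t t₀ < ε → γ t ∈ f) : False := by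
  -- a parameter just below `t₀`, mapped into `f` but not into `U₁`
  set tL := max a (t₀ - ε / 2) with htL
  have htLI : tL ∈ Icc a b := ⟨le_max_left _ _, max_le (hat₀.le.trans ht₀b) (by linarith)⟩
  have htLlt : tL < t₀ := max_lt hat₀ (by linarith)
  have hdL : dist tL t₀ < ε := by
    rw [Real.dist_eq, abs_sub_comm, abs_of_nonneg (by linarith)]
    have : t₀ - ε / 2 ≤ tL := le_max_right _ _
    linarith
  have hLf : γ tL ∈ f := htrap tL htLI htLlt.ne hdL
  have hLU : γ tL ∉ U₁ := hbefore tL ⟨le_max_left _ _, htLlt.le⟩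
  rcases hf.subset_or_subset hU₁ hU₂ hdisj hfU with h | h
  · exact hLU (h hLf)
  · obtain ⟨t, ⟨ht₀t, htε⟩, htb, htU⟩ := hafter ε hε
    have htI : t ∈ Icc a b := ⟨hat₀.le.trans ht₀t.le, htb⟩
    have hd : dist t t₀ < ε := by
      rw [Real.dist_eq, abs_of_nonneg (by linarith)]
      linarith
    exact hdisj.le_bot ⟨htU, h (htrap t htI ht₀t.ne' hd)⟩

end Summit.CriticalPhenomena.CardyFormulaZ2.Cruxes.SLESixFamiliesGiveCardy.CollarTouchSandwich
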